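import Mathlib
import Literature.Analysis.FluidPDE.SelfSimilarEulerProfile
import Summits.NavierStokesRegularity.NavierStokesRegularity.Theorems.EulerZoomLiouvillePowerGaugeEulerLiouvilleClassicalProfilePoisson

/-!
# R49 plate t52-GT: the GRADIENT-TEST IDENTITY (nsreg-p2 ROUND-49 «EVERY BALL BREATHES», `NsregP2.R49.GradientTestIdentity`,
text VERBATIM from `r49/Sketch49.lean` 6056058e6f0ef80f l.60–67; seat ns-ezl-w2 g5, `--supports stmt-NavierStokesRegularity-19832 --as helper`)

For a `γ`-profile `(V, P)` with ANY similarity centre `c` (`(1−γ)V + DV[γ(y−c) + V] + ∇P = 0`, `div V = 0`, `V ∈ C²`, `P ∈ C¹`)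
and every `X ∈ C²_c(ℝ³)`:  `∫ (⟪V, D(∇X)[V]⟫ + P · div ∇X) dy = 0` — stationary Euler's weak pressure equation `−ΔP = ∂ᵢ∂ⱼ(VᵢVⱼ)`,
γ-free: tested against a gradient, the similarity terms `(1−γ)V`, `γ(y·∇)V` and `−γ(c·∇)V` integrate to zero because `div V = 0`
(tree: `ClassicalProfile.integral_inner_gradient_eq_zero`, `…integral_inner_fderiv_self_gradient_eq_zero`; new here:
`integral_inner_fderiv_const_gradient_eq_zero`).  The centre-`0` engine is the tree's `ClassicalProfile.pressure_poisson`.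

HONEST FRAMING: whole-space integration by parts (a ROUND-49 instrument statement); nothing about the crux E (19832 OPEN) or NS
regularity. [cite: ChaeWolf2016, §2 (weak pressure equation); nsreg-p2 R49 §1.1; folklore]
-/

noncomputable section

set_option linter.dupNamespace false

open MeasureTheory Set Filter Topology Metric Function TopologicalSpace
open scoped ENNReal NNReal RealInnerProductSpace ContDiff Laplacian

namespace Summit.NavierStokesRegularity.NavierStokesRegularity.Theorems.PowerGaugeEulerLiouville

open Literature.Analysis Literature.Analysis.FunctionSpaces Literature.Analysis.FluidPDE

namespace ClassicalProfile

variable {V : EuclideanSpace ℝ (Fin 3) → EuclideanSpace ℝ (Fin 3)} {θ : EuclideanSpace ℝ (Fin 3) → ℝ}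

/-- **The constant-direction similarity term drops out against gradients**: `∫ ⟪DV(x) c, ∇θ(x)⟫ dx = 0` for `V ∈ C¹` divergence
free, `θ ∈ C²_c` and a fixed vector `c` (trilinear identity with `u ≡ c`, then `D²θ(x)[c][V] = D²θ(x)[V][c] = ⟪V, ∇(Dθ(·) c)⟫`
and `∫ ⟪V, ∇φ⟫ = 0`). [folklore] -/
theorem integral_inner_fderiv_const_gradient_eq_zero (hV : ContDiff ℝ 1 V) (hdiv : VectorCalculus.IsDivFree V)
    (hθ : ContDiff ℝ 2 θ) (hθc : HasCompactSupport θ) (c : EuclideanSpace ℝ (Fin 3)) :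
    ∫ x, ⟪fderiv ℝ V x c, gradient θ x⟫ = 0 := by
  have hu : ContDiff ℝ 1 (fun _ : EuclideanSpace ℝ (Fin 3) => c) := contDiff_const
  have h := integral_inner_convect_add_eq_zero hu hV (contDiff_one_gradient hθ) (hasCompactSupport_gradient hθc)
  have hdivc : ∀ x, VectorCalculus.divergence (fun _ : EuclideanSpace ℝ (Fin 3) => c) x = 0 := by
    intro x; simp [VectorCalculus.divergence]
  simp only [convect_apply, hdivc, zero_mul, integral_zero, add_zero] at h
  -- the auxiliary scalar `φ(y) = Dθ(y) c`
  have hφ : ContDiff ℝ 1 (fun y => fderiv ℝ θ y c) := (hθ.fderiv_right (m := 1) le_rfl).clm_apply contDiff_const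
  have hφc : HasCompactSupport (fun y => fderiv ℝ θ y c) :=
    (hθc.fderiv (𝕜 := ℝ)).mono fun x hx => by
      intro h0
      exact hx (by simp [h0])
  have hfd : ∀ x, DifferentiableAt ℝ (fderiv ℝ θ) x := fun x =>
    ((hθ.fderiv_right (m := 1) le_rfl).differentiable one_ne_zero) x
  have hsymm : ∀ x, fderiv ℝ (fderiv ℝ θ) x c (V x) = fderiv ℝ (fderiv ℝ θ) x (V x) c := fun x =>
    (hθ.contDiffAt.isSymmSndFDerivAt (by simp)).eq c (V x)
  have h2 : ∀ x, ⟪V x, fderiv ℝ (gradient θ) x c⟫ = ⟪V x, gradient (fun y => fderiv ℝ θ y c) x⟫ := by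
    intro x
    rw [inner_fderiv_gradient hθ, hsymm, real_inner_comm, FluidPDE.inner_gradient_left,
      fderiv_clm_apply (hfd x) (differentiableAt_const c), fderiv_fun_const]
    simp
  have h3 : ∫ x, ⟪V x, fderiv ℝ (gradient θ) x c⟫ = 0 := by
    rw [integral_congr_ae (Eventually.of_forall h2)]
    exact integral_inner_gradient_eq_zero hV hdiv hφ hφc
  linarith

/-- **GRADIENT-TEST IDENTITY** (`NsregP2.R49.GradientTestIdentity γ`, text verbatim): for a `γ`-profile `(V, P)` with any centre `c`
and every `X ∈ C²` with compact support, `∫ (⟪V, D(∇X)(y)[V]⟫ + P · div ∇X) dy = 0`.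
[cite: ChaeWolf2016, §2; nsreg-p2 R49 §1.1; folklore] -/
theorem gradientTestIdentity (γ : ℝ) :
    ∀ (c : EuclideanSpace ℝ (Fin 3)) (V : EuclideanSpace ℝ (Fin 3) → EuclideanSpace ℝ (Fin 3)) (P : EuclideanSpace ℝ (Fin 3) → ℝ),
      IsSelfSimilarEulerProfile γ c V P →
      ∀ (X : EuclideanSpace ℝ (Fin 3) → ℝ), ContDiff ℝ 2 X → HasCompactSupport X →
        ∫ y, (⟪V y, fderiv ℝ (gradient X) y (V y)⟫ + P y * VectorCalculus.divergence (gradient X) y) = 0 := by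
  intro c V P hprof X hX hXc
  have hV1 : ContDiff ℝ 1 V := hprof.contDiff_velocity.of_le (by norm_cast)
  have hP1 : ContDiff ℝ 1 P := hprof.contDiff_pressure
  have hdiv : VectorCalculus.IsDivFree V := hprof.divFree
  have hX1 : ContDiff ℝ 1 X := hX.of_le (by norm_cast)
  -- the profile equation paired with `∇X`, pointwise
  have hpt : ∀ x, ⟪fderiv ℝ V x (V x), gradient X x⟫ + ⟪gradient P x, gradient X x⟫ =
      -((1 - γ) * ⟪V x, gradient X x⟫) - γ * ⟪fderiv ℝ V x x, gradient X x⟫ + γ * ⟪fderiv ℝ V x c, gradient X x⟫ := by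
    intro x
    have h := congrArg (fun w => ⟪w, gradient X x⟫) (hprof.profile_eq x)
    simp only [map_add, map_smul, map_sub, smul_sub, inner_add_left, inner_sub_left, inner_smul_left, inner_zero_left,
      RCLike.conj_to_real] at h
    linarith
  have hiC : Integrable (fun x => ⟪fderiv ℝ V x (V x), gradient X x⟫) volume :=
    integrable_inner_gradient_of_continuous ((hV1.continuous_fderiv one_ne_zero).clm_apply hV1.continuous) hX1 hXc
  have hiP : Integrable (fun x => ⟪gradient P x, gradient X x⟫) volume :=
    integrable_inner_gradient_of_continuous (continuous_gradient_of_contDiff hP1) hX1 hXc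
  have hiV : Integrable (fun x => ⟪V x, gradient X x⟫) volume :=
    integrable_inner_gradient_of_continuous hV1.continuous hX1 hXc
  have hiS : Integrable (fun x => ⟪fderiv ℝ V x x, gradient X x⟫) volume :=
    integrable_inner_gradient_of_continuous ((hV1.continuous_fderiv one_ne_zero).clm_apply continuous_id) hX1 hXc
  have hiK : Integrable (fun x => ⟪fderiv ℝ V x c, gradient X x⟫) volume :=
    integrable_inner_gradient_of_continuous ((hV1.continuous_fderiv one_ne_zero).clm_apply continuous_const) hX1 hXc
  have hint : (∫ x, ⟪fderiv ℝ V x (V x), gradient X x⟫) + ∫ x, ⟪gradient P x, gradient X x⟫ =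
      -((1 - γ) * ∫ x, ⟪V x, gradient X x⟫) - γ * (∫ x, ⟪fderiv ℝ V x x, gradient X x⟫)
        + γ * ∫ x, ⟪fderiv ℝ V x c, gradient X x⟫ := by
    have i1 : Integrable (fun x => -((1 - γ) * ⟪V x, gradient X x⟫)) volume := (hiV.const_mul _).neg
    have i2 : Integrable (fun x => γ * ⟪fderiv ℝ V x x, gradient X x⟫) volume := hiS.const_mul _
    have i12 : Integrable (fun x => -((1 - γ) * ⟪V x, gradient X x⟫) - γ * ⟪fderiv ℝ V x x, gradient X x⟫) volume :=
      i1.sub i2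
    have i3 : Integrable (fun x => γ * ⟪fderiv ℝ V x c, gradient X x⟫) volume := hiK.const_mul _
    rw [← integral_add hiC hiP, ← integral_const_mul, ← integral_const_mul, ← integral_const_mul, ← integral_neg,
      ← integral_sub i1 i2, ← integral_add i12 i3]
    exact integral_congr_ae (Eventually.of_forall fun x => by simp only [hpt x])
  rw [integral_inner_convect_gradient hV1 hdiv hX hXc, integral_inner_gradient_gradient hP1 hX hXc,
    integral_inner_gradient_eq_zero hV1 hdiv hX1 hXc, integral_inner_fderiv_self_gradient_eq_zero hV1 hdiv hX hXc,
    integral_inner_fderiv_const_gradient_eq_zero hV1 hdiv hX hXc c] at hint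
  -- `hint : −∫ D²X(V,V) − ∫ P ΔX = 0`; rewrite the goal's integrand in the same terms
  have h1 : ∀ y, ⟪V y, fderiv ℝ (gradient X) y (V y)⟫ = fderiv ℝ (fderiv ℝ X) y (V y) (V y) := fun y =>
    inner_fderiv_gradient hX y (V y) (V y)
  have h2 : ∀ y, P y * VectorCalculus.divergence (gradient X) y = P y * (Δ X) y := fun y => by
    rw [divergence_gradient hX]
  have hi1 : Integrable (fun y => fderiv ℝ (fderiv ℝ X) y (V y) (V y)) volume := by
    refine ((((hX.fderiv_right (m := 1) le_rfl).continuous_fderiv one_ne_zero).clm_apply hV1.continuous).clm_apply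
      hV1.continuous).integrable_of_hasCompactSupport ?_
    refine ((hXc.fderiv (𝕜 := ℝ)).fderiv (𝕜 := ℝ)).mono fun x hx => ?_
    rw [mem_support] at hx ⊢
    contrapose! hx
    simp [hx]
  have hi2 : Integrable (fun y => P y * (Δ X) y) volume := by
    refine (hP1.continuous.mul (continuous_laplacian hX)).integrable_of_hasCompactSupport ?_
    refine (hXc.mono' ?_).mul_left
    intro x hx
    rw [mem_support] at hx
    contrapose! hx
    exact laplacian_eq_zero_of_notMem_tsupport hx
  rw [integral_congr_ae (Eventually.of_forall fun y => show
      ⟪V y, fderiv ℝ (gradient X) y (V y)⟫ + P y * VectorCalculus.divergence (gradient X) y =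
        fderiv ℝ (fderiv ℝ X) y (V y) (V y) + P y * (Δ X) y by rw [h1, h2]),
    integral_add hi1 hi2]
  linarith

end ClassicalProfile

end Summit.NavierStokesRegularity.NavierStokesRegularity.Theorems.PowerGaugeEulerLiouville

end
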